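import Summits.QuantumFields.BalabanUV.Beta.EriceRemainderEnclosureHistoryAutonomyComparisonAgeCompositionDecayBoundaryFlowFacts
import Summits.QuantumFields.BalabanUV.Beta.EriceRemainderEnclosureHistoryAutonomyComparisonAgeCompositionDecaySlotFlow
import Summits.QuantumFields.BalabanUV.Beta.EriceRemainderEnclosureHistoryAutonomyComparisonAgeCompositionDecayBoundaryOldCertificate
import Summits.QuantumFields.BalabanUV.Beta.EriceRemainderEnclosureHistoryAutonomyComparisonAgeCompositionDecayBoundaryYoungCertificate

/-!
# EriceRemainderEnclosureHistoryAutonomyComparisonAgeCompositionDecayBoundaryFlow — (E85e) route (N), first order: THE FIRST SLOT MERGED WITH THE BOUNDARY OF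
# THE (S-d) BUDGET ALONG A TWO-AGE FLOW — the slot of the pin `m+2` pays its own debits, the extra window damping `F_{m+2}` and the last factor `DE` out of
# its step credit, the old decay step's credit and the deep slots' surpluses, by the scalar certificates of (E85b)∕(E85c) at the flow's level ratios

Cell `pub-balaban`, β-function sub-cell, BINDER row D4 «RemainderConst leaves for Bałaban's split» (`HOME/BINDER-OWNERS.md`; owner lineage `b2b-balaban-beta-an4`;
this file by co-owner #2 lineage `b2b-balaban-beta-d4-p2`, generation 76), β-FLOW TEAM duty (1), FREEZE (0) honoured (def-free; imports (E85e₁)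
`…DecayBoundaryFlowFacts`, (E85b) `…DecayBoundaryOldCertificate`, (E85c) `…DecayBoundaryYoungCertificate`; uses (E82b)∕(E84c)∕(E84d)∕(E85d) window facts and the
certificates BY NAME; nothing restated).  Successor item (E84d-2), the pin `m+2` and the boundary.

HONEST FRAMING (page 1, verbatim and binding).  *"Discharging BetaPertH makes Bałaban's UV stability UNCONDITIONAL — a real constructive-QFT result; it is
NOT the continuum limit and NOT the Clay problem."*  THIS FILE DISCHARGES NOTHING OF THE KIND.  Elementary real analysis about ABSTRACT functionals on a box
]0,γ]^ℕ with displayed floors, profiles and signs, and the FIRST-ORDER renewal objects of route (N) built from them — hypotheses of a census, not facts; the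
form, signs, ages and moments of Bałaban's (1.22) limit functional are NOT PRINTED ([I] p. 298; GAPS G-t4-U2-1∕-2) and NOT asserted.  Row D4 class
UNCHANGED (critical-path width 0; instance 0∕1; D4 DISCHARGE NO DATE).  HONEST DEPENDENCY: continuum YM on T⁴ ⇐ BetaPertH ∧ nine spine estimates (0/9
proved); BetaPertH ⇐ (D1) ∧ (D4) ∧ CAP+tail; G-an2-4 gates asym, D1 and NE2/3/4.

THE POINT (census sense (α); route (N); README `HOME/b2b-balaban-beta-d4-p2/g76/e85/README.md`).  §1 **`slot_first_merged`**: along every two-age flow and at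
every pin `m`, `d_{m+2}Hup_{m+2} < 1` and `F_{m+1} + c_{m+2}∕(1−c_{m+2}) + ϑ_{m+2}ω_{m+2} + F_{m+2} + DE ≤ A_{m+2} + A_{m+k} + Σ_{q∈[m+3,m+2+k)} (4∕3)d_{q+1}` — the slot of
the first pin with the boundary of (E84c) `budget_of_slots` folded in.  Per unit `c₁ = c_{m+3}`, `d₁ = d_{m+3}` it is `c₁·MO + d₁·MY ≥ 0`: the credits are (E84c)
`step_ge_reads` at `m+2` (`≥ 3c₁Rt² + 3d₁w²`) and at `m+k` (`≥ 3c₁(lt)²q' + 3d₁g³`), the fund is (E85e₁) `fund_ge`, the defect is at most `(t²−1)(3∕(2t²)+1∕2)`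
((E84c) `defect_up_le`, (E82b) `load_le_half_step`), `F_{m+1} = d₁(vw)³ + c₁(lt)³`, `F_{m+2} = d₁w³ + c₁t³`, `c_{m+2} = c₁t³ = x∕k`, and the last factor
`DE ≤ d₁w³Ĥ∕(1 − wĤ∕6)` (`Hup ≤ Ĥ`, `d_{m+2} = d₁w³ ≤ w∕6` since the young read is at most half the step `≤ 1∕3`, (E85e₁) `hat_small`, `de_bound`); the
certificates' hypotheses are the window facts `relStep_le_step`, `relStep_le_relStep`, `read_sq_tangent`, `inner_rise_ge_reads`, `windowRatio_mono`,
`invSq_add_le_tangent`, `step_le_of_window`, `load_le_of_window`.  NOT CLAIMED: anything nonlinear; three or more loaded ages; anything printed.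

WHAT IS PROVED ([folklore]; 0 `def`, 0 sorry).  §1 **`slot_first_merged`**.
-/
noncomputable section
open Finset

namespace Summit.QuantumFields.BalabanUV.Beta.EriceRemainderEnclosureHistoryAutonomyComparisonAgeCompositionDecayBoundaryFlow

open Literature.MathematicalPhysics.QuantumFieldTheory.Balaban1983to89
open Literature.MathematicalPhysics.QuantumFieldTheory.Balaban1983to89.T4BetaStationary
open Literature.MathematicalPhysics.QuantumFieldTheory.Balaban1983to89.T4BetaFlowWellPosed
open Summit.QuantumFields.BalabanUV.Beta.EriceRemainderEnclosureHistoryAutonomyOrder (strictAnti_of_memFlow)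
open Summit.QuantumFields.BalabanUV.Beta.EriceRemainderEnclosureHistoryAutonomyComparisonAffineProfile (increment_anti)
open Summit.QuantumFields.BalabanUV.Beta.EriceRemainderEnclosureHistoryAutonomyComparisonAgeCompositionYoungestTailSumFlow (load_le_half_step
  step_le_of_window load_le_of_window)
open Summit.QuantumFields.BalabanUV.Beta.EriceRemainderEnclosureHistoryAutonomyComparisonAgeCompositionDecayBudgetSlots (step_ge_reads defect_up_le
  step_le_inv)
open Summit.QuantumFields.BalabanUV.Beta.EriceRemainderEnclosureHistoryAutonomyComparisonAgeCompositionDecayBudgetWindow (invSq_add_le_tangent)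
open Summit.QuantumFields.BalabanUV.Beta.EriceRemainderEnclosureHistoryAutonomyComparisonAgeCompositionDecaySlotFlow (two_age_load relStep_le_step
  read_sq_tangent inner_rise_ge_reads)
open Summit.QuantumFields.BalabanUV.Beta.EriceRemainderEnclosureHistoryAutonomyComparisonAgeCompositionDecayBoundaryOldCertificate (merged_old_cert
  merged_old_two)
open Summit.QuantumFields.BalabanUV.Beta.EriceRemainderEnclosureHistoryAutonomyComparisonAgeCompositionDecayBoundaryYoungCertificate (merged_young_cert
  merged_young_two)

variable {B : (ℕ → ℝ) → ℝ} {γ b gIR : ℝ} {L : ℕ → ℝ} {K : ℕ} {h : ℕ → ℝ}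

open Summit.QuantumFields.BalabanUV.Beta.EriceRemainderEnclosureHistoryAutonomyComparisonAgeCompositionDecayBoundaryFlowFacts (relStep_le_relStep fund_ge
  de_bound hat_small combine_merged combine_merged_two windowRatio_mono)

/-! ## §1 The merged first slot along the flow -/

/-- **THE FIRST SLOT MERGED WITH THE BOUNDARY, ALONG A TWO-AGE FLOW.**  Two-age profile `{1, k}` (`2 ≤ k`, `K = k+1`), `h` a box solution of an isotone memory
with floor dominated by `L ≥ 0`; `c_n = L_kh_{n+k}³∕2`, `d_n = L_1h_{n+1}³∕2`, `F_t = Σ_jL_jh_{t+j}³∕2`, `Hup_p` the flow majorant of (E84a).  At every pin `m`: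
`d_{m+2}Hup_{m+2} < 1`, and the merged inequality `F_{m+1} + c_{m+2}∕(1−c_{m+2}) + ϑ_{m+2}ω_{m+2} + F_{m+2} + d_{m+2}Hup_{m+2}∕(1 − d_{m+2}Hup_{m+2}) ≤
A_{m+2} + A_{m+k} + Σ_{q∈[m+3,m+2+k)} (4∕3)d_{q+1}` of the allocation of (E84c) `budget_of_slots` (the surplus of the slot `m+2` being whatever the boundary
needs).  PROOF: per unit `c₁ = c_{m+3}` and `d₁ = d_{m+3}` the inequality is `c₁·MO + d₁·MY ≥ 0` with (E85b) `merged_old_cert` ∕ `merged_old_two` and (E85c)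
`merged_young_cert` ∕ `merged_young_two` at the flow's ratios: the credits are (E84c) `step_ge_reads` at `m+2` and `m+k`, the fund is §1 `fund_ge`, the last
factor is bounded through `Hup ≤ Ĥ` ((E84c) `defect_up_le`, (E82b) `load_le_half_step`), `d_{m+2} ≤ w∕6` and §1 `hat_small` ∕ `de_bound`; the hypotheses of
the certificates are the window facts of (E82b)∕(E84c)∕(E84d)∕(E85d) and §1 `windowRatio_mono`. [folklore] -/
theorem slot_first_merged (hmono : ∀ u v : ℕ → ℝ, SeqBox γ u → SeqBox γ v → (∀ j, u j ≤ v j) → B u ≤ B v)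
    (hL : ∀ k, 0 ≤ L k) (hb : 0 < b) (hlo : ∀ u, SeqBox γ u → b ≤ B u) (hdom : ∀ u, SeqBox γ u → ∑ k ∈ range K, L k * u k ≤ B u)
    (hh : SeqBox γ h) (hf : MemFlow B gIR h) {k : ℕ} (hk2 : 2 ≤ k) (hKk : K = k + 1) (hL2 : ∀ j, j < K → j ≠ 1 → j ≠ k → L j = 0)
    {c d F Hup : ℕ → ℝ} (hc : ∀ n, c n = L k * h (n + k) ^ 3 / 2) (hd : ∀ n, d n = L 1 * h (n + 1) ^ 3 / 2)
    (hF : ∀ t, F t = ∑ j ∈ range K, L j * h (t + j) ^ 3 / 2)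
    (hHup : ∀ p, Hup p = (1 + (1 - (h (p + k + 1) / h (p + k)) ^ 3 / (1 + F (p + k + 1))) * ((k * c p) / (1 - k * c p))) / (1 - c p))
    (m : ℕ) :
    d (m + 2) * Hup (m + 2) < 1 ∧
    F (m + 1) + c (m + 2) / (1 - c (m + 2))
      + (1 - (h (m + 2 + k + 1) / h (m + 2 + k)) ^ 3 / (1 + F (m + 2 + k + 1))) * ((k * c (m + 2)) / (1 - k * c (m + 2)))
      + F (m + 2) + d (m + 2) * Hup (m + 2) / (1 - d (m + 2) * Hup (m + 2))
      ≤ 3 / 2 * ((1 - (h (m + 2 + 1) / h (m + 2)) ^ 2) + (1 - (h (m + 2 + 1) / h (m + 2)) ^ 2) ^ 2 / 2)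
        + 3 / 2 * ((1 - (h (m + k + 1) / h (m + k)) ^ 2) + (1 - (h (m + k + 1) / h (m + k)) ^ 2) ^ 2 / 2)
        + ∑ q ∈ Ico (m + 3) (m + 2 + k), 4 / 3 * d (q + 1) := by
  have hpos : ∀ n, 0 < h n := fun n => (hh n).1
  have hanti := (strictAnti_of_memFlow hb hlo hh hf).antitone
  have hkK : k < K := by omega
  have h1K : 1 < K := by omega
  have hk1 : k ≠ 1 := by omega
  have hkr : (2 : ℝ) ≤ k := by exact_mod_cast hk2
  have hk0 : (0 : ℝ) < k := by linarith
  -- unfold the abstract letters and normalise indices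
  simp only [hHup, hF, hc, hd]
  simp only [show m + 2 + k = m + k + 2 by omega, show m + k + 2 + 1 = m + k + 3 from rfl, show m + 2 + 1 = m + 3 from rfl]
  have P2 := hpos (m + 2); have P3 := hpos (m + 3); have P4 := hpos (m + 4); have Pk1 := hpos (m + 1 + k); have Pk2 := hpos (m + k + 2)
  have Pk3 := hpos (m + k + 3)
  -- flow facts (before introducing letters)
  have hy3 : 1 - (h (m + 3) / h (m + 2)) ^ 2 ≤ 1 / 3 := by
    have hy := step_le_inv hmono hb hlo hh hf (m + 2)
    have : 1 / ((((m + 2 : ℕ)) : ℝ) + 1) ≤ 1 / 3 := by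
      rw [div_le_div_iff₀ (by positivity) (by norm_num)]; push_cast; linarith [(Nat.cast_nonneg m : (0:ℝ) ≤ m)]
    exact hy.trans this
  have hy0 : 0 ≤ 1 - (h (m + 3) / h (m + 2)) ^ 2 := by
    have h1 : h (m + 3) / h (m + 2) ≤ 1 := (div_le_one P2).mpr (hanti (by omega))
    have h0 : 0 ≤ h (m + 3) / h (m + 2) := div_nonneg P3.le P2.le
    nlinarith only [h1, h0]
  have hreads := step_ge_reads hL hdom hh hf h1K hkK hk1 (m + 2)
  rw [show m + 2 + 1 = m + 3 from rfl, show m + 2 + 2 = m + 4 from rfl, show m + 2 + k + 1 = m + k + 3 by omega] at hreads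
  have hreadsb := step_ge_reads hL hdom hh hf h1K hkK hk1 (m + k)
  rw [show m + k + k + 1 = m + 2 * k + 1 by ring] at hreadsb
  have hz3 := relStep_le_step hmono hb hlo hh hf (show m + 2 + 1 ≤ m + 3 by omega)
  rw [show m + 2 + 1 = m + 3 from rfl] at hz3
  have hF0 : 0 ≤ ∑ j ∈ range K, L j * h (m + k + 3 + j) ^ 3 / 2 :=
    sum_nonneg fun j _ => by have := hL j; have := hpos (m + k + 3 + j); positivity
  have hhalf := load_le_half_step hL hb hlo hdom hh hf (m + k + 2); rw [show m + k + 2 + 1 = m + k + 3 by omega] at hhalf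
  have hwin := load_le_of_window hmono hL hb hlo hdom hh hf (show 1 ≤ m + 2 by omega) hkK
  rw [show m + 2 + k = m + k + 2 by omega] at hwin
  have hstep := step_le_of_window hmono hb hlo hh hf (m + 2) k
  rw [show m + 2 + k + 1 = m + k + 3 by omega, show m + 2 + k = m + k + 2 by omega] at hstep
  have eF1 := two_age_load (h := h) hk2 hKk hL2 (m + 1)
  rw [show m + 1 + 1 = m + 2 from rfl] at eF1
  have eF2 := two_age_load (h := h) hk2 hKk hL2 (m + 2)
  rw [show m + 2 + 1 = m + 3 from rfl, show m + 2 + k = m + k + 2 by omega] at eF2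
  have htan := invSq_add_le_tangent hmono hb hlo hh hf (m + 3) (k - 1)
  rw [show m + 3 + (k - 1) = m + k + 2 by omega, show m + 3 + 1 = m + 4 from rfl, Nat.cast_sub (by omega : 1 ≤ k), Nat.cast_one] at htan
  have hfund0 := fund_ge hmono hL hb hlo hh hf (show 1 ≤ k by omega) m
  rw [show m + 2 + k = m + k + 2 by omega] at hfund0
  have hfund : L 1 * h (m + 4) ^ 3 / 2 * (64 / 3 * (1 / Real.sqrt 5 - 1 / Real.sqrt (k + 4)))
      ≤ ∑ q ∈ Ico (m + 3) (m + k + 2), 4 / 3 * (L 1 * h (q + 1 + 1) ^ 3 / 2) := le_trans hfund0 (le_of_eq (sum_congr rfl fun q _ => rfl))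
  clear hfund0
  have hrm := windowRatio_mono hmono hb hlo hh hf (m + 2) k
  rw [show m + 2 + k = m + k + 2 by omega, show m + 2 + 1 + k = m + k + 3 by omega, show m + 2 + 1 = m + 3 from rfl] at hrm
  -- the letters
  set c1 := L k * h (m + k + 3) ^ 3 / 2 with hc1
  set d1 := L 1 * h (m + 4) ^ 3 / 2 with hd1
  set t := h (m + k + 2) / h (m + k + 3) with ht
  set l := h (m + 1 + k) / h (m + k + 2) with hl
  set w := h (m + 3) / h (m + 4) with hw
  set v := h (m + 2) / h (m + 3) with hv
  set R := (h (m + 3) / h (m + k + 2)) ^ 2 with hR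
  set x := (k : ℝ) * (L k * h (m + k + 2) ^ 3 / 2) with hx
  set σ := 1 - (h (m + k + 2) / h (m + 2)) ^ 2 with hσ
  set q := h (m + 2 + 2 * k) / h (m + k + 2) with hq
  set q' := h (m + 2 * k + 1) / h (m + k + 3) with hq'
  set g := h (m + k + 2) / h (m + 4) with hg
  clear_value c1 d1 t l w v R x σ q q' g
  have hc10 : 0 ≤ c1 := by rw [hc1]; have := hL k; positivity
  have hd10 : 0 ≤ d1 := by rw [hd1]; have := hL 1; positivity
  have ht1 : 1 ≤ t := by rw [ht, le_div_iff₀ Pk3, one_mul]; exact hanti (by omega)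
  have hl1 : 1 ≤ l := by rw [hl, le_div_iff₀ Pk2, one_mul]; exact hanti (by omega)
  have hw1 : 1 ≤ w := by rw [hw, le_div_iff₀ P4, one_mul]; exact hanti (by omega)
  have hv1 : 1 ≤ v := by rw [hv, le_div_iff₀ P3, one_mul]; exact hanti (by omega)
  have hg0 : 0 < g := by rw [hg]; exact div_pos Pk2 P4
  have hR1 : 1 ≤ R := by
    have : 1 ≤ h (m + 3) / h (m + k + 2) := by rw [le_div_iff₀ Pk2, one_mul]; exact hanti (by omega)
    rw [hR]; nlinarith only [this]
  have ht0 : 0 < t := by linarith only [ht1]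
  have hv0 : 0 < v := by linarith only [hv1]
  have hw0 : 0 < w := by linarith only [hw1]
  -- identities between the letters
  have ecp : L k * h (m + k + 2) ^ 3 / 2 = c1 * t ^ 3 := by rw [hc1, ht, div_pow]; field_simp
  have exk : x / k = c1 * t ^ 3 := by rw [hx, ← ecp]; field_simp
  have ex : x = k * (c1 * t ^ 3) := by rw [hx, ecp]
  have eold : L k * h (m + 1 + k) ^ 3 / 2 = c1 * (l * t) ^ 3 := by rw [hc1, hl, ht, mul_pow, div_pow, div_pow]; field_simp
  have eyng : L 1 * h (m + 2) ^ 3 / 2 = d1 * (v * w) ^ 3 := by rw [hd1, hv, hw, mul_pow, div_pow, div_pow]; field_simp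
  have edp : L 1 * h (m + 3) ^ 3 / 2 = d1 * w ^ 3 := by rw [hd1, hw, div_pow]; field_simp
  have ev2 : (h (m + 3) / h (m + 2)) ^ 2 = 1 / v ^ 2 := by rw [hv, div_pow, div_pow, one_div_div]
  have hgR : g ^ 2 * R = w ^ 2 := by rw [hg, hR, hw, div_pow, div_pow, div_pow]; field_simp
  -- `v² ≤ 3/2`
  have hvy : v ^ 2 ≤ 3 / 2 := by
    have h23 : 2 / 3 ≤ 1 / v ^ 2 := by rw [← ev2]; linarith
    rw [le_div_iff₀ (by positivity)] at h23; linarith only [h23]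
  -- `w² ≤ 1 + y`, `w² ≤ 4/3`
  have hvw : v ^ 2 * w ^ 2 ≤ 2 * v ^ 2 - 1 := by
    rw [ev2] at hz3
    have hvv : 0 < v ^ 2 := by positivity
    have h1 : w ^ 2 ≤ 2 - 1 / v ^ 2 := by linarith only [hz3]
    have h2 := mul_le_mul_of_nonneg_left h1 hvv.le
    rw [mul_sub, mul_one_div_cancel hvv.ne'] at h2
    linarith only [h2]
  have hwy : w ^ 2 ≤ 4 / 3 := by
    have h1 : w ^ 2 * v ^ 2 ≤ 4 / 3 * v ^ 2 := by nlinarith only [hvw, hvy]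
    exact le_of_mul_le_mul_right h1 (by positivity)
  have hwR : w ^ 2 ≤ R := by
    rw [hw, hR, div_pow, div_pow]
    exact div_le_div_of_nonneg_left (by positivity) (pow_pos Pk2 2) (pow_le_pow_left₀ Pk2.le (hanti (by omega)) 2)
  have hRk : R ≤ 1 + (k - 1) * (w ^ 2 - 1) := by
    have h3 := pow_pos P3 2
    have := mul_le_mul_of_nonneg_left htan h3.le
    have e1 : h (m + 3) ^ 2 * (1 / h (m + k + 2) ^ 2) = R := by rw [hR, div_pow]; field_simp
    have e2 : h (m + 3) ^ 2 * (1 / h (m + 3) ^ 2 + ((k : ℝ) - 1) * (1 / h (m + 4) ^ 2 - 1 / h (m + 3) ^ 2)) = 1 + (k - 1) * (w ^ 2 - 1) := by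
      rw [hw, div_pow]; field_simp
    rw [e1, e2] at this; exact this
  have htw : t ≤ w := by
    have h1 := relStep_le_relStep hmono hb hlo hh hf (show m + 3 ≤ m + k + 2 by omega)
    rw [show m + 3 + 1 = m + 4 from rfl, show m + k + 2 + 1 = m + k + 3 from rfl] at h1
    have : t ^ 2 ≤ w ^ 2 := by rw [ht, hw]; linarith only [h1]
    exact (pow_le_pow_iff_left₀ ht0.le hw0.le two_ne_zero).mp this
  -- the credit at the pin: `y ≥ 2 d1 w² + 2 c1 R t²`
  have hcredit : 2 * d1 * w ^ 2 + 2 * c1 * R * t ^ 2 ≤ 1 - (h (m + 3) / h (m + 2)) ^ 2 := by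
    have e1 : L 1 * h (m + 3) ^ 2 * h (m + 4) = 2 * d1 * w ^ 2 := by rw [hd1, hw, div_pow]; field_simp
    have e2 : L k * h (m + 3) ^ 2 * h (m + k + 3) = 2 * c1 * R * t ^ 2 := by rw [hc1, hR, ht, div_pow, div_pow]; field_simp
    linarith only [hreads, e1, e2]
  -- the defect
  have hdef : 1 - (h (m + k + 3) / h (m + k + 2)) ^ 3 / (1 + ∑ j ∈ range K, L j * h (m + k + 3 + j) ^ 3 / 2)
      ≤ (t ^ 2 - 1) * (3 / (2 * t ^ 2) + 1 / 2) := by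
    have hs0 : 0 ≤ h (m + k + 3) / h (m + k + 2) := div_nonneg Pk3.le Pk2.le
    have hs1 : h (m + k + 3) / h (m + k + 2) ≤ 1 := (div_le_one Pk2).mpr (hanti (by omega))
    have h1 := defect_up_le hs0 hs1 hF0
    have es : (h (m + k + 3) / h (m + k + 2)) ^ 2 = 1 / t ^ 2 := by rw [ht, div_pow, div_pow, one_div_div]
    rw [es] at h1
    have e3 : (t ^ 2 - 1) * (3 / (2 * t ^ 2) + 1 / 2) = 3 / 2 * (1 - 1 / t ^ 2) + (t ^ 2 - 1) / 2 := by field_simp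
    rw [e3]; linarith only [h1, hhalf]
  -- window mass, rise and step caps
  have hx0 : 0 ≤ x := by rw [hx]; have := hL k; positivity
  have hxa : 4 * x ≤ 3 * σ := hwin
  have hσR : σ ≤ 1 - 2 / (3 * R) := by
    have e : (h (m + k + 2) / h (m + 2)) ^ 2 * R = (h (m + 3) / h (m + 2)) ^ 2 := by
      rw [hR, div_pow, div_pow, div_pow]; field_simp
    have h23 : 2 / 3 ≤ (h (m + 3) / h (m + 2)) ^ 2 := by linarith only [hy3]
    have hRpos : 0 < R := by linarith only [hR1]
    have es2 : (h (m + k + 2) / h (m + 2)) ^ 2 = (h (m + 3) / h (m + 2)) ^ 2 / R := eq_div_of_mul_eq hRpos.ne' e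
    have key : 2 / (3 * R) ≤ (h (m + k + 2) / h (m + 2)) ^ 2 := by
      rw [es2, ← div_div]; exact div_le_div_of_nonneg_right h23 hRpos.le
    rw [hσ]; linarith only [key]
  have hσ1 : σ < 1 := by
    have : 0 < (h (m + k + 2) / h (m + 2)) ^ 2 := by positivity
    rw [hσ]; linarith only [this]
  have hx1 : x < 1 := by linarith only [hxa, hσ1]
  have hkt : (k : ℝ) * (t ^ 2 - 1) ≤ σ := hstep
  have htl : t ≤ l := by
    have h1 := relStep_le_relStep hmono hb hlo hh hf (show m + 1 + k ≤ m + k + 2 by omega)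
    rw [show m + 1 + k + 1 = m + k + 2 by ring, show m + k + 2 + 1 = m + k + 3 from rfl] at h1
    have : t ^ 2 ≤ l ^ 2 := by rw [ht, hl]; linarith only [h1]
    exact (pow_le_pow_iff_left₀ ht0.le (le_trans zero_le_one hl1) two_ne_zero).mp this
  have hly : l ^ 2 ≤ 4 / 3 := by
    have h1 := relStep_le_step hmono hb hlo hh hf (show m + 2 + 1 ≤ m + 1 + k by omega)
    rw [show m + 1 + k + 1 = m + k + 2 by ring, show m + 2 + 1 = m + 3 from rfl] at h1
    rw [hl]; linarith only [h1, hy3]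
  have hlR : l ^ 2 ≤ R := by
    rw [hl, hR, div_pow, div_pow]
    exact div_le_div_of_nonneg_right (pow_le_pow_left₀ Pk1.le (hanti (by omega)) 2) (by positivity)
  have hlσ : ((k : ℝ) - 1) * (l ^ 2 - 1) ≤ σ := by
    obtain ⟨j, hj⟩ : ∃ j, k = j + 1 := ⟨k - 1, by omega⟩
    have h1 := step_le_of_window hmono hb hlo hh hf (m + 2) j
    have ej : (j : ℝ) = k - 1 := by rw [hj]; push_cast; ring
    rw [show m + 2 + j = m + 1 + k by omega, show m + 1 + k + 1 = m + k + 2 by omega, ej] at h1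
    rw [hl, hσ]
    refine h1.trans ?_
    have h2 : (h (m + k + 2) / h (m + 2)) ^ 2 ≤ (h (m + 1 + k) / h (m + 2)) ^ 2 := by
      rw [div_pow, div_pow]; exact div_le_div_of_nonneg_right (pow_le_pow_left₀ Pk2.le (hanti (by omega)) 2) (by positivity)
    linarith only [h2]
  have hq0 : 0 < q := by rw [hq]; exact div_pos (hpos _) Pk2
  have hq1 : 1 ≤ q ^ 2 * (1 + σ) := by
    have h1 := read_sq_tangent hmono hb hlo hh hf (m + 2) k k le_rfl
    rw [hq, hσ]; rwa [show m + 2 + k + k = m + 2 + 2 * k by ring, show m + 2 + k = m + k + 2 by omega] at h1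
  have hCin : 2 * x * (1 - 1 / k) * R * q ≤ R - 1 := by
    have h1 := inner_rise_ge_reads hL hb hlo hdom hh hf h1K hkK (by omega) hk1 (m + 2)
    rw [hx, hR, hq]; rwa [show m + 2 + 1 = m + 3 from rfl, show m + 2 + k = m + k + 2 by omega] at h1
  have hq'0 : 0 < q' := by rw [hq']; exact div_pos (hpos _) Pk3
  have hq'1 : 3 ≤ k → 1 ≤ q' ^ 2 * (1 + σ) := by
    intro hk3
    have h1 := read_sq_tangent hmono hb hlo hh hf (m + 3) k (k - 2) (by omega)
    rw [show m + 3 + k + (k - 2) = m + 2 * k + 1 by omega, show m + 3 + k = m + k + 3 by ring] at h1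
    have h2 : 1 - (h (m + k + 3) / h (m + 3)) ^ 2 ≤ σ := by rw [hσ]; linarith only [hrm]
    rw [hq']
    exact h1.trans (mul_le_mul_of_nonneg_left (by linarith only [h2]) (sq_nonneg _))
  -- the old decay step's credit (for `k ≥ 3`): `Yb ≥ 2 d1 g³ + 2 c1 (lt)² q'`
  have hAb : 2 * d1 * g ^ 3 + 2 * c1 * ((l * t) ^ 2 * q') ≤ 1 - (h (m + k + 1) / h (m + k)) ^ 2 := by
    have e1 : L k * h (m + k + 1) ^ 2 * h (m + 2 * k + 1) = 2 * c1 * ((l * t) ^ 2 * q') := by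
      rw [hc1, hl, ht, hq', show m + 1 + k = m + k + 1 by ring, mul_pow, div_pow, div_pow]; field_simp
    have e2 : L 1 * h (m + k + 2) ^ 3 = 2 * d1 * g ^ 3 := by rw [hd1, hg, div_pow]; field_simp
    have h3 : L 1 * h (m + k + 2) ^ 3 ≤ L 1 * h (m + k + 1) ^ 2 * h (m + k + 2) := by
      rw [pow_succ, ← mul_assoc]
      exact mul_le_mul_of_nonneg_right (mul_le_mul_of_nonneg_left (pow_le_pow_left₀ Pk2.le (hanti (by omega)) 2) (hL 1)) Pk2.le
    linarith only [hreadsb, e1, e2, h3]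
  have hYb0 : 0 ≤ 1 - (h (m + k + 1) / h (m + k)) ^ 2 := by
    have h1 : h (m + k + 1) / h (m + k) ≤ 1 := (div_le_one (hpos _)).mpr (hanti (by omega))
    have h0 : 0 ≤ h (m + k + 1) / h (m + k) := div_nonneg (hpos _).le (hpos _).le
    nlinarith only [h1, h0]
  -- rewrite the goal in the letters
  have exk' : 1 - x / k = 1 - c1 * t ^ 3 := by rw [exk]
  rw [eF1, eF2, eyng, eold, edp, ecp, ← exk']
  have eG : c1 * t ^ 3 / (1 - x / k) = c1 * (t ^ 3 / (1 - x / k)) := mul_div_assoc _ _ _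
  rw [eG]
  -- the last factor
  have hEH0 : 0 ≤ (t ^ 2 - 1) * (3 / (2 * t ^ 2) + 1 / 2) := mul_nonneg (by nlinarith only [ht1]) (by positivity)
  have hω0 : 0 ≤ x / (1 - x) := div_nonneg hx0 (by linarith)
  have hdenk : 0 < 1 - x / k := by
    have : x / k ≤ x / 2 := div_le_div_of_nonneg_left hx0 (by norm_num) hkr
    linarith only [this, hx1]
  have hHupH : (1 + (1 - (h (m + k + 3) / h (m + k + 2)) ^ 3 / (1 + ∑ j ∈ range K, L j * h (m + k + 3 + j) ^ 3 / 2)) * (x / (1 - x))) / (1 - x / k)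
      ≤ (1 + (t ^ 2 - 1) * (3 / (2 * t ^ 2) + 1 / 2) * (x / (1 - x))) / (1 - x / k) :=
    div_le_div_of_nonneg_right (by linarith only [mul_le_mul_of_nonneg_right hdef hω0]) hdenk.le
  have hHup0 : 0 ≤ (1 + (1 - (h (m + k + 3) / h (m + k + 2)) ^ 3 / (1 + ∑ j ∈ range K, L j * h (m + k + 3 + j) ^ 3 / 2)) * (x / (1 - x)))
      / (1 - x / k) := by
    have hs0 : 0 ≤ h (m + k + 3) / h (m + k + 2) := div_nonneg Pk3.le Pk2.le
    have hs1 : h (m + k + 3) / h (m + k + 2) ≤ 1 := (div_le_one Pk2).mpr (hanti (by omega))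
    have hθ0 : 0 ≤ 1 - (h (m + k + 3) / h (m + k + 2)) ^ 3 / (1 + ∑ j ∈ range K, L j * h (m + k + 3 + j) ^ 3 / 2) := by
      have h3 : (h (m + k + 3) / h (m + k + 2)) ^ 3 ≤ 1 := pow_le_one₀ hs0 hs1
      have : (h (m + k + 3) / h (m + k + 2)) ^ 3 / (1 + ∑ j ∈ range K, L j * h (m + k + 3 + j) ^ 3 / 2) ≤ (h (m + k + 3) / h (m + k + 2)) ^ 3 :=
        div_le_self (pow_nonneg hs0 3) (by linarith only [hF0])
      linarith only [h3, this]
    exact div_nonneg (by have := mul_nonneg hθ0 hω0; linarith only [this]) hdenk.le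
  have hhat := hat_small hkr hw1 hwy hR1 hRk ht1 hkt hσR hx0 (by linarith only [hxa])
  have hdpw : d1 * w ^ 3 ≤ w / 6 := by
    have h0 : 0 ≤ c1 * (R * t ^ 2) := mul_nonneg hc10 (mul_nonneg (le_trans zero_le_one hR1) (sq_nonneg t))
    have h1 : d1 * w ^ 2 ≤ 1 / 6 := by linarith only [hcredit, hy3, h0]
    nlinarith only [h1, hw0]
  generalize hH : (1 + (t ^ 2 - 1) * (3 / (2 * t ^ 2) + 1 / 2) * (x / (1 - x))) / (1 - x / k) = Hh at hHupH hhat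
  generalize hHu : (1 + (1 - (h (m + k + 3) / h (m + k + 2)) ^ 3 / (1 + ∑ j ∈ range K, L j * h (m + k + 3 + j) ^ 3 / 2)) * (x / (1 - x)))
      / (1 - x / k) = Hu at hHupH hHup0 ⊢
  have hHh0 : 0 ≤ Hh := hHup0.trans hHupH
  have hδ : d1 * w ^ 3 * Hh ≤ w * Hh / 6 := by
    have := mul_le_mul_of_nonneg_right hdpw hHh0; linarith only [this]
  have hδ1 : w * Hh / 6 < 1 := by linarith only [hhat]
  have hd3 : 0 ≤ d1 * w ^ 3 := mul_nonneg hd10 (pow_nonneg hw0.le 3)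
  have hDE := de_bound hd3 hHup0 hHupH hδ hδ1
  have hdH1 : d1 * w ^ 3 * Hu < 1 := by
    have := mul_le_mul_of_nonneg_left hHupH hd3; linarith only [this, hδ, hδ1]
  refine ⟨hdH1, ?_⟩
  -- the defect term per unit `c1`
  have e4 : t ^ 3 * (3 / (2 * t ^ 2) + 1 / 2) = (3 * t + t ^ 3) / 2 := by
    have htne : t ≠ 0 := ht0.ne'
    field_simp
  have eV : (t ^ 2 - 1) * (3 / (2 * t ^ 2) + 1 / 2) * (x / (1 - x)) = c1 * ((k : ℝ) * (t ^ 2 - 1) * (3 * t + t ^ 3) / (2 * (1 - x))) := by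
    rw [ex]
    calc (t ^ 2 - 1) * (3 / (2 * t ^ 2) + 1 / 2) * ((k : ℝ) * (c1 * t ^ 3) / (1 - (k : ℝ) * (c1 * t ^ 3)))
        = (t ^ 2 - 1) * k * c1 * (t ^ 3 * (3 / (2 * t ^ 2) + 1 / 2)) / (1 - (k : ℝ) * (c1 * t ^ 3)) := by ring
      _ = (t ^ 2 - 1) * k * c1 * ((3 * t + t ^ 3) / 2) / (1 - (k : ℝ) * (c1 * t ^ 3)) := by rw [e4]
      _ = c1 * ((k : ℝ) * (t ^ 2 - 1) * (3 * t + t ^ 3) / (2 * (1 - (k : ℝ) * (c1 * t ^ 3)))) := by rw [div_mul_eq_div_div]; ring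
  have hV : (1 - (h (m + k + 3) / h (m + k + 2)) ^ 3 / (1 + ∑ j ∈ range K, L j * h (m + k + 3 + j) ^ 3 / 2)) * (x / (1 - x))
      ≤ c1 * ((k : ℝ) * (t ^ 2 - 1) * (3 * t + t ^ 3) / (2 * (1 - x))) := (mul_le_mul_of_nonneg_right hdef hω0).trans (le_of_eq eV)
  have hDE' : d1 * w ^ 3 * Hu / (1 - d1 * w ^ 3 * Hu) ≤ d1 * (w ^ 3 * (Hh / (1 - w * Hh / 6))) := by
    refine hDE.trans (le_of_eq ?_); ring
  refine le_trans (add_le_add (add_le_add (add_le_add le_rfl hV) le_rfl) hDE') ?_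
  generalize hY : 1 - (h (m + 3) / h (m + 2)) ^ 2 = Y at hcredit hy0 hy3 ⊢
  generalize hYb : 1 - (h (m + k + 1) / h (m + k)) ^ 2 = Yb at hAb hYb0 ⊢
  clear hDE hDE' hV eV e4 hHupH hHup0 hHu hδ hdpw hdef hF0 hhalf hwin hstep eF1 eF2 eyng eold edp ev2 hreads hreadsb hz3 htan hrm hmono hdom hL2
  rcases eq_or_lt_of_le hk2 with hk22 | hk3
  · -- k = 2
    have hk2r : (k : ℝ) = 2 := by exact_mod_cast hk22.symm
    have elw : l = w := by rw [hl, hw, show m + 1 + k = m + 3 by omega, show m + k + 2 = m + 4 by omega]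
    have eRw : R = w ^ 2 := by rw [hR, hw, show m + k + 2 = m + 4 by omega]
    have h2t : 2 * (t ^ 2 - 1) ≤ σ := by rw [← hk2r]; exact hkt
    have hσw : σ ≤ 1 - 2 / (3 * w ^ 2) := by rw [← eRw]; exact hσR
    have hMO := merged_old_two ht1 hw1 htw hwy h2t hσw hx0 hxa
    have hMY := merged_young_two hw1 hwy hv1 hvy ht1 htw h2t hσw hx0 hxa
    have hH2 : (1 + (t ^ 2 - 1) * (3 / (2 * t ^ 2) + 1 / 2) * (x / (1 - x))) / (1 - x / 2) = Hh := by rw [← hH, hk2r]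
    rw [hH2] at hMY
    -- the fund for k = 2 is the single surplus `(4/3) d_{m+4} = (4/3) d1/t³`
    have efund : ∑ q ∈ Ico (m + 3) (m + k + 2), 4 / 3 * (L 1 * h (q + 1 + 1) ^ 3 / 2) = d1 * (4 / 3 / t ^ 3) := by
      rw [show m + k + 2 = m + 3 + 1 by omega, Nat.Ico_succ_singleton, sum_singleton, hd1, ht, show m + k + 2 = m + 4 by omega,
        show m + k + 3 = m + 3 + 1 + 1 by omega, div_pow]
      field_simp
    have eYb : Yb = Y := by rw [← hY, ← hYb, show m + k + 1 = m + 3 by omega, show m + k = m + 2 by omega]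
    rw [efund, eYb, elw]; rw [eRw] at hcredit
    exact combine_merged_two hk2r hc10 hd10 hMO hMY hcredit le_rfl le_rfl
  · -- k ≥ 3
    have hk3r : (3 : ℝ) ≤ k := by exact_mod_cast hk3
    have hMO := merged_old_cert hk3r hR1 ht1 hl1 htl hly hlR hlσ hkt hσR hx0 hxa hq0 hq1 hCin hq'0 (hq'1 hk3)
    have hFnd : 64 / 3 * (1 / Real.sqrt 5 - 1 / Real.sqrt (k + 4)) ≤ 64 / 3 * (1 / Real.sqrt 5 - 1 / Real.sqrt (k + 4)) := le_rfl
    have hMY := merged_young_cert hk3r hw1 hwy hwR hRk hg0 hgR hv1 hvy ht1 htw hkt hσR hx0 hxa hq0 hq1 hCin hFnd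
    rw [hH] at hMY
    exact combine_merged hc10 hd10 hMO hMY hcredit hAb hfund le_rfl

end Summit.QuantumFields.BalabanUV.Beta.EriceRemainderEnclosureHistoryAutonomyComparisonAgeCompositionDecayBoundaryFlow

end
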